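/-
Copyright (c) 2026 the pub-hodgecm-mathlib formalisation cell (harness21).  Prover seat hodgecm-mathlib-K2E3-p23 (g5), HCML Track B «K2-LIT» ∕ h413
(`stmt-HodgeConjecture-24833`), line `K2_E3_EllipticInputs`, unit U12 «Characters», road «GL-[M6]-sc» (line lead K2E3-p23 (g5), dealer K2E3-plan (g3)),
MEMO «M6sc-BLUEPRINT v4» §2 brick VOL-mixed, FILE A′: Levi-part bookkeeping for `P_{(2,1)} = M ⋉ U`.  2026-09-04.
-/
import Summits.HodgeConjecture.HodgeConjecture.Theorems.K2E3GL3MixedShearCount   -- ★ FILE A p858233 (this seat): entries of `U`, `M`; `det(1 − K_p)`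
import HarnessLib

/-!
# Road «GL-[M6]-sc», brick VOL-mixed, FILE A′: THE LEVI PART OF A `P_{(2,1)}`-ELEMENT IS READ OFF `𝔅`; `u p u⁻¹ ∈ U · p`; `det K_p` AT A LEVI ELEMENT

Cell `pub/hodgecm-mathlib` (D-0151), Track B «K2-LIT», crux H413 = `stmt-HodgeConjecture-24833`, route of record `HCCMUnconditional`.  Lane
`--supports stmt-HodgeConjecture-24833 --as helper`; THEOREMS ONLY (no `def`, no `instance`, no `notation`, no named-fact hypothesis, no `sorry`); count-neutral.
The three bookkeeping facts the VOL-mixed assembly (FILE C) needs on top of ★ FILE A (`c = ![false,false,true]`, `U = N_{(2,1)}`, `M = GL₂ × GL₁`):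
* **`adBall_of_adBall_unipotent_mul_levi`** — `𝔅_m(u p) ⇒ 𝔅_m(p)` for `u ∈ U`, `p ∈ M` (every product `p_{ij}(p⁻¹)_{kl}` is `0` or one of the products of `u p`; entries
  `unipotent_mul_apply_eq`, `unipotent_mul_inv_apply_eq`);
* `exists_unipotent_conj_eq_mul`, **`exists_unipotent_conj_conj_eq_mul`** — `v (u p u⁻¹) v⁻¹ = u″ · (v p v⁻¹)` with `u″ ∈ U`, `v p v⁻¹ ∈ M` (`u ∈ U`, `p, v ∈ M`): so in the `k·n·a`
  count `𝔅_m(z γ z⁻¹)` FORCES `𝔅_m(γ_β)` for the Levi conjugate `γ_β = (v a) γ (v a)⁻¹` whose `x`-sections ★ FILE B counts;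
* **`det_boxAd_of_mem_standardLeviGL`** — `det K_p = (p₀₀p₁₁ − p₀₁p₁₀) · ((p⁻¹)₂₂)²` (`= 1` at the root-group element `τ_x`, so `Ad(τ_x)` preserves `μ_U`, ★ FILE A
  `measure_setOf_adBall_conj_conj_eq`).
HONEST LABEL: HC_CM is proved only modulo the 7 printed citations (2 remaining named inputs: hLiu418 = stmt-HodgeConjecture-24832, h413 = stmt-HodgeConjecture-24833) until
rung 0 closes; count-neutral helper, closes no socket.

## References
* [HarishChandra1970] Harish-Chandra (notes by G. van Dijk), *Harmonic Analysis on Reductive p-adic Groups*, LNM 162 (1970), Part VII §3 p. 72.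
* [BernsteinZelevinsky1977] I. N. Bernstein, A. V. Zelevinsky, *Induced representations of reductive p-adic groups I* (1977), §2.1, 1.7.
-/

set_option autoImplicit false
-- the mandated namespace repeats the single-problem summit's segment (`HodgeConjecture.HodgeConjecture`)
set_option linter.dupNamespace false

noncomputable section

open scoped MatrixGroups WithZero
open Matrix
open Literature.NumberTheory.Automorphic
open Summit.HodgeConjecture.HodgeConjecture.Cruxes.H413.K2E3GL3MixedShearCount

namespace Summit.HodgeConjecture.HodgeConjecture.Cruxes.H413.K2E3GL3MixedLeviPart

variable {F : Type*} [Field F]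

/-! ## §1 The Levi part of a `P`-element is read off `𝔅`; `u p u⁻¹ ∈ U·p`; `det K_p` at a Levi element -/

/-- **`(u p)_{ij} = p_{ij}`** off the column `2` of the block rows — precisely for `j ∈ {0,1}` or `(i,j) = (2,2)` — when `u ∈ U_{(2,1)}`, `p ∈ M_{(2,1)}`. [folklore] -/
theorem unipotent_mul_apply_eq {u p : GL (Fin 3) F} (hu : u ∈ unipotentRadicalGL F (![false, false, true] : Fin 3 → Bool))
    (hp : p ∈ standardLeviGL F (![false, false, true] : Fin 3 → Bool)) {i j : Fin 3} (hij : (j = 0 ∨ j = 1) ∨ (i = 2 ∧ j = 2)) :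
    ((u * p : GL (Fin 3) F) : Matrix (Fin 3) (Fin 3) F) i j = (p : Matrix (Fin 3) (Fin 3) F) i j := by
  rw [Units.val_mul, Matrix.mul_apply, Fin.sum_univ_three]
  rcases hij with hj | ⟨rfl, rfl⟩
  · -- `p_{2j} = 0` and the first two columns of `u` are those of `1`
    have hp2 : (p : Matrix (Fin 3) (Fin 3) F) 2 j = 0 := apply_eq_zero_of_mem_levi hp (by rcases hj with rfl | rfl <;> decide)
    have h0 : (u : Matrix (Fin 3) (Fin 3) F) i 0 = (1 : Matrix (Fin 3) (Fin 3) F) i 0 := apply_eq_one_apply_of_mem hu (by rintro ⟨_, h⟩; exact absurd h (by decide))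
    have h1 : (u : Matrix (Fin 3) (Fin 3) F) i 1 = (1 : Matrix (Fin 3) (Fin 3) F) i 1 := apply_eq_one_apply_of_mem hu (by rintro ⟨_, h⟩; exact absurd h (by decide))
    rw [hp2, mul_zero, add_zero, h0, h1]
    fin_cases i <;> simp [Matrix.one_apply, hp2]
  · rw [apply_eq_zero_of_mem_levi hp (i := 0) (j := 2) (by decide), apply_eq_zero_of_mem_levi hp (i := 1) (j := 2) (by decide), mul_zero, mul_zero,
      zero_add, zero_add, apply_two_two_of_mem hu, one_mul]

/-- **`((u p)⁻¹)_{kl} = (p⁻¹)_{kl}`** for `l ∈ {0,1}` or `(k,l) = (2,2)`, `u ∈ U_{(2,1)}`, `p ∈ M_{(2,1)}` (`(u p)⁻¹ = p⁻¹ u⁻¹`, and right multiplication by `u⁻¹` only alters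
column `2` above the corner). [folklore] -/
theorem unipotent_mul_inv_apply_eq {u p : GL (Fin 3) F} (hu : u ∈ unipotentRadicalGL F (![false, false, true] : Fin 3 → Bool))
    (hp : p ∈ standardLeviGL F (![false, false, true] : Fin 3 → Bool)) {k l : Fin 3} (hkl : (l = 0 ∨ l = 1) ∨ (k = 2 ∧ l = 2)) :
    (((u * p)⁻¹ : GL (Fin 3) F) : Matrix (Fin 3) (Fin 3) F) k l = ((p⁻¹ : GL (Fin 3) F) : Matrix (Fin 3) (Fin 3) F) k l := by
  have hu' : u⁻¹ ∈ unipotentRadicalGL F (![false, false, true] : Fin 3 → Bool) := Subgroup.inv_mem _ hu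
  have hp' : p⁻¹ ∈ standardLeviGL F (![false, false, true] : Fin 3 → Bool) := Subgroup.inv_mem _ hp
  rw [_root_.mul_inv_rev, Units.val_mul, Matrix.mul_apply, Fin.sum_univ_three]
  rcases hkl with hl | ⟨rfl, rfl⟩
  · rw [apply_eq_one_apply_of_mem hu' (i := 0) (j := l) (by rcases hl with rfl | rfl <;> decide),
      apply_eq_one_apply_of_mem hu' (i := 1) (j := l) (by rcases hl with rfl | rfl <;> decide),
      apply_eq_one_apply_of_mem hu' (i := 2) (j := l) (by rcases hl with rfl | rfl <;> decide)]
    rcases hl with rfl | rfl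
    · rw [Matrix.one_apply_eq, Matrix.one_apply_ne (by decide), Matrix.one_apply_ne (by decide), mul_one, mul_zero, mul_zero, add_zero, add_zero]
    · rw [Matrix.one_apply_ne (by decide), Matrix.one_apply_eq, Matrix.one_apply_ne (by decide), mul_zero, mul_one, mul_zero, zero_add, add_zero]
  · rw [apply_eq_zero_of_mem_levi hp' (i := 2) (j := 0) (by decide), apply_eq_zero_of_mem_levi hp' (i := 2) (j := 1) (by decide), zero_mul, zero_mul,
      zero_add, zero_add, apply_two_two_of_mem hu', mul_one]

/-- **THE LEVI PART OF A `P`-ELEMENT IS READ OFF `𝔅`: `𝔅_m(u p) ⇒ 𝔅_m(p)`** for `u ∈ U_{(2,1)}`, `p ∈ M_{(2,1)}` — every product `p_{ij}(p⁻¹)_{kl}` is either `0` or one of the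
products `(u p)_{ij}((u p)⁻¹)_{kl}`. [cite: HarishChandra1970, Part VII §3 p. 72] -/
theorem adBall_of_adBall_unipotent_mul_levi [Valued F ℤᵐ⁰] {ϖ : F} {m : ℕ} {u p : GL (Fin 3) F} (hu : u ∈ unipotentRadicalGL F (![false, false, true] : Fin 3 → Bool))
    (hp : p ∈ standardLeviGL F (![false, false, true] : Fin 3 → Bool))
    (h : ∀ i j k l, Valued.v (ϖ ^ m * (((u * p : GL (Fin 3) F) : Matrix (Fin 3) (Fin 3) F) i j * (((u * p)⁻¹ : GL (Fin 3) F) : Matrix (Fin 3) (Fin 3) F) k l)) ≤ 1)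
    (i j k l : Fin 3) : Valued.v (ϖ ^ m * ((p : Matrix (Fin 3) (Fin 3) F) i j * ((p⁻¹ : GL (Fin 3) F) : Matrix (Fin 3) (Fin 3) F) k l)) ≤ 1 := by
  have hp' : p⁻¹ ∈ standardLeviGL F (![false, false, true] : Fin 3 → Bool) := Subgroup.inv_mem _ hp
  by_cases hij : (j = 0 ∨ j = 1) ∨ (i = 2 ∧ j = 2)
  · by_cases hkl : (l = 0 ∨ l = 1) ∨ (k = 2 ∧ l = 2)
    · rw [← unipotent_mul_apply_eq hu hp hij, ← unipotent_mul_inv_apply_eq hu hp hkl]; exact h i j k l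
    · -- `(p⁻¹)_{k2} = 0` for `k ≤ 1`
      have hk : (![false, false, true] : Fin 3 → Bool) k ≠ (![false, false, true] : Fin 3 → Bool) l := by
        fin_cases k <;> fin_cases l <;> simp_all
      rw [apply_eq_zero_of_mem_levi hp' hk, mul_zero, mul_zero, map_zero]; exact zero_le
  · have hk : (![false, false, true] : Fin 3 → Bool) i ≠ (![false, false, true] : Fin 3 → Bool) j := by
      fin_cases i <;> fin_cases j <;> simp_all
    rw [apply_eq_zero_of_mem_levi hp hk, zero_mul, mul_zero, map_zero]; exact zero_le

/-- **`u p u⁻¹ = u′ · p` with `u′ ∈ U`** for `u ∈ U_{(2,1)}`, `p ∈ M_{(2,1)}` (`u′ = u · (p u⁻¹ p⁻¹)`, `M` normalises `U`). [cite: BernsteinZelevinsky1977, §2.1] -/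
theorem exists_unipotent_conj_eq_mul {u p : GL (Fin 3) F} (hu : u ∈ unipotentRadicalGL F (![false, false, true] : Fin 3 → Bool))
    (hp : p ∈ standardLeviGL F (![false, false, true] : Fin 3 → Bool)) :
    ∃ u' ∈ unipotentRadicalGL F (![false, false, true] : Fin 3 → Bool), u * p * u⁻¹ = u' * p := by
  refine ⟨u * (p * u⁻¹ * p⁻¹), Subgroup.mul_mem _ hu (conj_mem_unipotentRadicalGL_of_mem_standardLeviGL _ hp (Subgroup.inv_mem _ hu)), by group⟩

/-- **`v (u p u⁻¹) v⁻¹ = u″ · (v p v⁻¹)` with `u″ ∈ U` and `v p v⁻¹ ∈ M`** for `u ∈ U`, `p, v ∈ M_{(2,1)}`. [cite: BernsteinZelevinsky1977, §2.1] -/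
theorem exists_unipotent_conj_conj_eq_mul {u p v : GL (Fin 3) F} (hu : u ∈ unipotentRadicalGL F (![false, false, true] : Fin 3 → Bool))
    (hp : p ∈ standardLeviGL F (![false, false, true] : Fin 3 → Bool)) (hv : v ∈ standardLeviGL F (![false, false, true] : Fin 3 → Bool)) :
    ∃ u'' ∈ unipotentRadicalGL F (![false, false, true] : Fin 3 → Bool), v * (u * p * u⁻¹) * v⁻¹ = u'' * (v * p * v⁻¹) ∧
      v * p * v⁻¹ ∈ standardLeviGL F (![false, false, true] : Fin 3 → Bool) := by
  obtain ⟨u', hu', h⟩ := exists_unipotent_conj_eq_mul hu hp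
  refine ⟨v * u' * v⁻¹, conj_mem_unipotentRadicalGL_of_mem_standardLeviGL _ hv hu', ?_, Subgroup.mul_mem _ (Subgroup.mul_mem _ hv hp) (Subgroup.inv_mem _ hv)⟩
  rw [h]; group

/-- **`det K_p = (p₀₀p₁₁ − p₀₁p₁₀) · w²`, `w = (p⁻¹)₂₂`, for `p ∈ M_{(2,1)}`** (the box matrix is `w · h`); for the root-group element `τ_x = 1 + xE₀₁`: `det K = 1`, so `Ad(τ_x)`
preserves the Haar measures of `U` (★ `exists_homeomorph_unipotentRadicalGL_parabolic_conj`). [cite: BernsteinZelevinsky1977, 1.7] -/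
theorem det_boxAd_of_mem_standardLeviGL (p : GL (Fin 3) F) (hp : p ∈ standardLeviGL F (![false, false, true] : Fin 3 → Bool)) :
    (Matrix.of fun q q' : {i : Fin 3 // (![false, false, true] : Fin 3 → Bool) i = false} × {j : Fin 3 // (![false, false, true] : Fin 3 → Bool) j = true} =>
      (((⟨p, standardLeviGL_le F _ hp⟩ : standardParabolicGL F (![false, false, true] : Fin 3 → Bool)) : GL (Fin 3) F) : Matrix (Fin 3) (Fin 3) F) q.1 q'.1 *
        ((((⟨p, standardLeviGL_le F _ hp⟩ : standardParabolicGL F (![false, false, true] : Fin 3 → Bool))⁻¹ : standardParabolicGL F (![false, false, true] : Fin 3 → Bool)) :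
          GL (Fin 3) F) : Matrix (Fin 3) (Fin 3) F) q'.2 q.2).det =
      ((p : Matrix (Fin 3) (Fin 3) F) 0 0 * (p : Matrix (Fin 3) (Fin 3) F) 1 1 - (p : Matrix (Fin 3) (Fin 3) F) 0 1 * (p : Matrix (Fin 3) (Fin 3) F) 1 0) *
        ((p⁻¹ : GL (Fin 3) F) : Matrix (Fin 3) (Fin 3) F) 2 2 ^ 2 := by
  classical
  set σ := {i : Fin 3 // (![false, false, true] : Fin 3 → Bool) i = false} × {j : Fin 3 // (![false, false, true] : Fin 3 → Bool) j = true} with hσ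
  let e : Fin 2 → σ := fun k => Fin.cases (⟨0, rfl⟩, ⟨2, rfl⟩) (fun _ => (⟨1, rfl⟩, ⟨2, rfl⟩)) k
  have he_inj : Function.Injective e := by
    intro a b hab
    fin_cases a <;> fin_cases b
    · rfl
    · exact absurd (congrArg (fun q : σ => ((q.1 : Fin 3) : ℕ)) hab) (by decide)
    · exact absurd (congrArg (fun q : σ => ((q.1 : Fin 3) : ℕ)) hab) (by decide)
    · rfl
  have he_surj : Function.Surjective e := by
    rintro ⟨⟨i, hi⟩, ⟨j, hj⟩⟩
    have hj2 : j = 2 := by fin_cases j <;> simp_all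
    subst hj2
    fin_cases i
    · exact ⟨0, rfl⟩
    · exact ⟨1, rfl⟩
    · simp at hi
  let E : Fin 2 ≃ σ := Equiv.ofBijective e ⟨he_inj, he_surj⟩
  set A : Matrix σ σ F := Matrix.of fun q q' : σ =>
      (((⟨p, standardLeviGL_le F _ hp⟩ : standardParabolicGL F (![false, false, true] : Fin 3 → Bool)) : GL (Fin 3) F) : Matrix (Fin 3) (Fin 3) F) q.1 q'.1 *
        ((((⟨p, standardLeviGL_le F _ hp⟩ : standardParabolicGL F (![false, false, true] : Fin 3 → Bool))⁻¹ : standardParabolicGL F (![false, false, true] : Fin 3 → Bool)) :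
          GL (Fin 3) F) : Matrix (Fin 3) (Fin 3) F) q'.2 q.2 with hA
  have hre : A.det = (Matrix.reindex E.symm E.symm A).det := (Matrix.det_reindex_self E.symm A).symm
  rw [hre, Matrix.det_fin_two]
  simp only [Matrix.reindex_apply, Matrix.submatrix_apply, Equiv.symm_symm, hA, Matrix.of_apply, Subgroup.coe_inv]
  have hE0 : E 0 = (⟨0, rfl⟩, ⟨2, rfl⟩) := rfl
  have hE1 : E 1 = (⟨1, rfl⟩, ⟨2, rfl⟩) := rfl
  simp only [hE0, hE1]
  change (p : Matrix (Fin 3) (Fin 3) F) 0 0 * ((p⁻¹ : GL (Fin 3) F) : Matrix (Fin 3) (Fin 3) F) 2 2 *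
      ((p : Matrix (Fin 3) (Fin 3) F) 1 1 * ((p⁻¹ : GL (Fin 3) F) : Matrix (Fin 3) (Fin 3) F) 2 2) -
      (p : Matrix (Fin 3) (Fin 3) F) 0 1 * ((p⁻¹ : GL (Fin 3) F) : Matrix (Fin 3) (Fin 3) F) 2 2 *
        ((p : Matrix (Fin 3) (Fin 3) F) 1 0 * ((p⁻¹ : GL (Fin 3) F) : Matrix (Fin 3) (Fin 3) F) 2 2) = _
  ring

end Summit.HodgeConjecture.HodgeConjecture.Cruxes.H413.K2E3GL3MixedLeviPart

end
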